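import Summits.CriticalPhenomena.PercolationContinuityZ3.Theorems.Transplant.FKConnectivityAllQForestAdjacentDegThree
import HarnessLib

/-!
# CONTRACTION MONOTONICITY of the square-free adjacent forest Rayleigh margin (node `AdjForestContractionMonoOn`, NOT asserted)
# and the kernel reduction: contraction monotonicity ⇒ the node `AdjForestRayleighNoSqOn` (two-line induction on the free pairs)

Support file (`--supports stmt-CriticalPhenomena-4575`), FK sub-lane `prim-bschramm-fk-1` (gen 24) of the post-continuity programme;
builds on p205010 (kernel theorem, internal audit signed; external expert review pending).  Two definitions (one counting predicate, one
`@[conjecture]` node — NOT asserted), no named facts, no sorries; standard axioms.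

THE NODE (♣)⁰ = `AdjForestRayleighNoSqOn V` (`…TwoClusterRayleighNoSq.lean`): on every fibre `(M, u₀)` and all `e = ov ≠ f = oy`,
`bad(M,u₀) := #(Fo ∩ {e,f ∈ ω}, Fo) ≤ good(M,u₀) := #(Fo ∩ {e ∈ ω}, Fo ∩ {f ∈ ω})` — the coefficients of the Rayleigh difference
`Δ_{ef}F = F_e^f F_f^e − F_{ef}F^{ef}` of the spanning-forest polynomial at an ADJACENT pair are non-negative (`margin := good − bad ≥ 0`;
the monomial of the fibre `(M,u₀)` has exponent 1 on `M` and 2 on `u₀`).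

NEW NODE — CONTRACTION MONOTONICITY (memo bschramm/FROM-fk-1-g24-HUB-EVENT-CALCULUS.md §4): **`margin(M, u₀) ≥ margin(M ∖ {g}, u₀ ∪ {g})`
for every free pair `g ∈ M` other than `e, f`** — moving a pair from the free part to the pinned (= contracted) part never increases the
margin; equivalently the coefficients of `Δ_{ef}F` are NON-INCREASING in each exponent `1 → 2`; in graph language `(Diff − Same)(G) ≥ (Diff − Same)(G/g)`
for every edge `g ∉ {e,f}` of a multigraph `G` (contraction; `g` may be far from `o`, inside `N(o)`, a star edge `oa`, or even `vy`).
CONJECTURE-SHAPED COUNTING STATEMENT, NOT asserted: `AdjForestContractionMonoOn V`, `@[conjecture] AdjForestContractionMonoPos`.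
EVIDENCE (exact, exhaustive; numerics/cm/cmtest.c, cm2.py, cm3.py of the unit): 0 failures over every connected simple graph with ≤ 8 vertices,
every `o`, every adjacent pair `e, f` at `o` and every edge `g ≠ e, f` (1,599,245 tests at n = 8, 106,982 at n = 7), and over 298,071 random
multigraph / larger tests; the coefficient triple `(margin(G−g), margin(G), margin(G/g))` is moreover LOG-CONCAVE in all of them, while
deletion-monotonicity `margin(G) ≥ margin(G−g)` and concavity are FALSE (so the statement is one-sided: exponent 1 → 2 only).
* **`adjForestRayleighNoSqOn_of_contractionMono : AdjForestContractionMonoOn V → AdjForestRayleighNoSqOn V`** (KERNEL, unconditional as an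
  implication): induction on the number of free pairs — pin the free pairs other than `e, f` one at a time (the margin only decreases), down to
  the base fibre `({e,f}, u₀)` where `bad ≤ 1 ≤ good` whenever `bad ≠ 0` (`u₀ ∪ {e,f} ∈ Fo` forces `u₀ ∪ {e}, u₀ ∪ {f} ∈ Fo`); the degenerate
  positions of `e, f` (outside `M ∪ u₀`: `bad = 0`; pinned: `bad = good` by the involution `ω ↦ ω ∆ M`) are equalities.
* **`adjForestRayleighNoSqPos_of_contractionMonoPos`**.
So (♣)⁰ — and with it adjacent-edge negative correlation of the arboreal gas on every finite graph (`ag_adjacent_negCorr_of_adjForestNoSq`) — is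
REDUCED to a monotonicity statement between TWO NEIGHBOURING COEFFICIENTS of the Rayleigh difference.
[cite: SempleWelsh2008, Conj. 1.1 (p. 2); Thm. 4.2 (p. 11)] [cite: CibulkaHladkyLaCroixWagner2008, Thm. 1 (p. 2)] [cite: Linusson2011, Prop. 2.6]
[cite: Grimmett2006, §1.5 (p. 13)]
-/

noncomputable section

namespace Summit.CriticalPhenomena.PercolationContinuityZ3.Theorems
namespace FK

open MeasureTheory Set Literature.Probability.LatticeModels Literature.Probability.Percolation
open scoped Classical symmDiff

variable {V : Type*} [Fintype V]

/-- **Contraction monotonicity of the adjacent forest Rayleigh margin on the vertex type `V`**: for every fibre `(M, u₀)`, all `o`, `v ≠ y`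
and every free pair `g ∈ M` other than `e = ov`, `f = oy`: `bad(M,u₀) + good(M∖{g}, u₀∪{g}) ≤ good(M,u₀) + bad(M∖{g}, u₀∪{g})`, i.e.
`margin(M,u₀) ≥ margin(M∖{g}, u₀∪{g})`.  CONJECTURE-SHAPED, NOT asserted. [cite: SempleWelsh2008, Conj. 1.1 (p. 2)] [cite: Linusson2011, Prop. 2.6] -/
def AdjForestContractionMonoOn (V : Type*) [Fintype V] : Prop :=
  ∀ (M u₀ : BondConfig V), Disjoint u₀ M → ∀ (o v y : V), v ≠ y → ∀ g ∈ M, g ≠ s(o, v) → g ≠ s(o, y) →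
    fibreCount M u₀ (forestEv V ∩ {ω | s(o, v) ∈ ω ∧ s(o, y) ∈ ω}) (forestEv V) +
        fibreCount (M \ {g}) (insert g u₀) (forestEv V ∩ {ω | s(o, v) ∈ ω}) (forestEv V ∩ {ω | s(o, y) ∈ ω}) ≤
      fibreCount M u₀ (forestEv V ∩ {ω | s(o, v) ∈ ω}) (forestEv V ∩ {ω | s(o, y) ∈ ω}) +
        fibreCount (M \ {g}) (insert g u₀) (forestEv V ∩ {ω | s(o, v) ∈ ω ∧ s(o, y) ∈ ω}) (forestEv V)

/-- **Contraction monotonicity on every finite vertex type.**  CONJECTURE-SHAPED COUNTING STATEMENT, NOT asserted (evidence in the module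
docstring: all graphs with ≤ 8 vertices, all positions of `g`). [cite: SempleWelsh2008, Conj. 1.1 (p. 2); Thm. 4.2 (p. 11)] -/
@[conjecture] def AdjForestContractionMonoPos : Prop := ∀ n : ℕ, AdjForestContractionMonoOn (Fin n)

/-! ### Two generic fibre-count facts -/

/-- A fibre count is at most one if the first event pins down the configuration on the fibre. [cite: Linusson2011, Prop. 2.6] -/
theorem fibreCount_le_one_of_forall_eq (M u : BondConfig V) (A B : Set (BondConfig V))
    (h : ∀ ω₁ ω₂ : BondConfig V, ω₁ \ M = u → ω₁ ∈ A → ω₂ \ M = u → ω₂ ∈ A → ω₁ = ω₂) : fibreCount M u A B ≤ 1 := by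
  unfold fibreCount
  refine Finset.card_le_one.2 fun ω₁ h₁ ω₂ h₂ => ?_
  rw [Finset.mem_filter] at h₁ h₂
  exact h ω₁ ω₂ h₁.2.1 h₁.2.2.1 h₂.2.1 h₂.2.2.1

/-- A non-zero fibre count has a witness. [cite: Linusson2011, Prop. 2.6] -/
theorem exists_of_fibreCount_ne_zero (M u : BondConfig V) (A B : Set (BondConfig V)) (h : fibreCount M u A B ≠ 0) :
    ∃ ω : BondConfig V, ω \ M = u ∧ ω ∈ A ∧ ω ∆ M ∈ B := by
  unfold fibreCount at h
  obtain ⟨ω, hω⟩ := Finset.card_ne_zero.1 h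
  rw [Finset.mem_filter] at hω
  exact ⟨ω, hω.2⟩

/-! ### The degenerate positions of `e, f` and the base fibre -/

section Base

variable {M u₀ : BondConfig V} {o v y : V}

/-- If `e ∉ M ∪ u₀` no configuration of the fibre contains `e`: `bad = 0`. [cite: Linusson2011, Prop. 2.6] -/
theorem adjForestNoSq_bad_eq_zero_of_notMem (heM : s(o, v) ∉ M) (heu : s(o, v) ∉ u₀) :
    fibreCount M u₀ (forestEv V ∩ {ω | s(o, v) ∈ ω ∧ s(o, y) ∈ ω}) (forestEv V) = 0 :=
  fibreCount_eq_zero_of_forall _ _ _ _ fun _ hω hA _ => ((subset_union_of_fibre hω).1 hA.2.1).elim heM heu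

/-- If `f ∉ M ∪ u₀`: `bad = 0`. [cite: Linusson2011, Prop. 2.6] -/
theorem adjForestNoSq_bad_eq_zero_of_notMem' (hfM : s(o, y) ∉ M) (hfu : s(o, y) ∉ u₀) :
    fibreCount M u₀ (forestEv V ∩ {ω | s(o, v) ∈ ω ∧ s(o, y) ∈ ω}) (forestEv V) = 0 :=
  fibreCount_eq_zero_of_forall _ _ _ _ fun _ hω hA _ => ((subset_union_of_fibre hω).1 hA.2.2).elim hfM hfu

omit [Fintype V] in
/-- A pinned pair lies in every configuration of the fibre and in its partner. [folklore] -/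
theorem mem_and_mem_symmDiff_of_mem_pinned {g : Sym2 V} (hd : Disjoint u₀ M) (hg : g ∈ u₀) {ω : BondConfig V} (hω : ω \ M = u₀) :
    g ∈ ω ∧ g ∈ ω ∆ M := by
  have hgM : g ∉ M := fun h => hd.le_bot ⟨hg, h⟩
  have hgω : g ∈ ω := (hω ▸ hg : g ∈ ω \ M).1
  exact ⟨hgω, Set.mem_symmDiff.2 (Or.inl ⟨hgω, hgM⟩)⟩

/-- If `e` is pinned (`e ∈ u₀`) then `bad = good` (involution `ω ↦ ω ∆ M`). [cite: Linusson2011, Prop. 2.6] -/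
theorem adjForestNoSq_bad_eq_good_of_pinned (hd : Disjoint u₀ M) (heu : s(o, v) ∈ u₀) :
    fibreCount M u₀ (forestEv V ∩ {ω | s(o, v) ∈ ω ∧ s(o, y) ∈ ω}) (forestEv V) =
      fibreCount M u₀ (forestEv V ∩ {ω | s(o, v) ∈ ω}) (forestEv V ∩ {ω | s(o, y) ∈ ω}) := by
  rw [fibreCount_swap M u₀ (forestEv V ∩ {ω | s(o, v) ∈ ω})]
  refine fibreCount_congr_fibre M u₀ fun ω hω => ?_
  have he := mem_and_mem_symmDiff_of_mem_pinned hd heu hω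
  constructor
  · rintro ⟨⟨hF, -, hf⟩, hFB⟩; exact ⟨⟨hF, hf⟩, hFB, he.2⟩
  · rintro ⟨⟨hF, hf⟩, hFB, -⟩; exact ⟨⟨hF, he.1, hf⟩, hFB⟩

/-- If `f` is pinned (`f ∈ u₀`) then `bad = good`. [cite: Linusson2011, Prop. 2.6] -/
theorem adjForestNoSq_bad_eq_good_of_pinned' (hd : Disjoint u₀ M) (hfu : s(o, y) ∈ u₀) :
    fibreCount M u₀ (forestEv V ∩ {ω | s(o, v) ∈ ω ∧ s(o, y) ∈ ω}) (forestEv V) =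
      fibreCount M u₀ (forestEv V ∩ {ω | s(o, v) ∈ ω}) (forestEv V ∩ {ω | s(o, y) ∈ ω}) := by
  refine fibreCount_congr_fibre M u₀ fun ω hω => ?_
  have hf := mem_and_mem_symmDiff_of_mem_pinned hd hfu hω
  constructor
  · rintro ⟨⟨hF, he, -⟩, hFB⟩; exact ⟨⟨hF, he⟩, hFB, hf.2⟩
  · rintro ⟨⟨hF, he⟩, hFB, -⟩; exact ⟨⟨hF, he, hf.1⟩, hFB⟩

/-- **The base fibre `M = {e, f}`**: `bad ≤ good` (if `u₀ ∪ {e,f}` and `u₀` are forests then so are `u₀ ∪ {e}` and `u₀ ∪ {f}`).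
[cite: SempleWelsh2008, Conj. 1.1 (p. 2)] [cite: Grimmett2006, §1.5 (p. 13)] -/
theorem adjForestNoSq_base (hvy : v ≠ y) (hM : M = {s(o, v), s(o, y)}) (hd : Disjoint u₀ M) :
    fibreCount M u₀ (forestEv V ∩ {ω | s(o, v) ∈ ω ∧ s(o, y) ∈ ω}) (forestEv V) ≤
      fibreCount M u₀ (forestEv V ∩ {ω | s(o, v) ∈ ω}) (forestEv V ∩ {ω | s(o, y) ∈ ω}) := by
  have hef : s(o, v) ≠ s(o, y) := fun h' => hvy (Sym2.congr_right.1 h')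
  have heu : s(o, v) ∉ u₀ := fun h => hd.le_bot ⟨h, hM ▸ Or.inl rfl⟩
  have hfu : s(o, y) ∉ u₀ := fun h => hd.le_bot ⟨h, hM ▸ Or.inr rfl⟩
  -- every `bad` configuration is `u₀ ∪ {e, f}`
  have huniq : ∀ ω : BondConfig V, ω \ M = u₀ → s(o, v) ∈ ω → s(o, y) ∈ ω → ω = insert s(o, y) (insert s(o, v) u₀) := by
    intro ω hω he hf
    ext x
    simp only [mem_insert_iff]
    constructor
    · intro hx
      by_cases hxM : x ∈ M
      · rw [hM] at hxM
        rcases hxM with rfl | rfl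
        · exact Or.inr (Or.inl rfl)
        · exact Or.inl rfl
      · exact Or.inr (Or.inr (hω ▸ ⟨hx, hxM⟩))
    · rintro (rfl | rfl | hx)
      · exact hf
      · exact he
      · exact ((hω.symm ▸ hx : x ∈ ω \ M)).1
  have hle : fibreCount M u₀ (forestEv V ∩ {ω | s(o, v) ∈ ω ∧ s(o, y) ∈ ω}) (forestEv V) ≤ 1 :=
    fibreCount_le_one_of_forall_eq _ _ _ _ fun ω₁ ω₂ h₁ hA₁ h₂ hA₂ => by
      rw [huniq ω₁ h₁ hA₁.2.1 hA₁.2.2, huniq ω₂ h₂ hA₂.2.1 hA₂.2.2]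
  by_cases hzero : fibreCount M u₀ (forestEv V ∩ {ω | s(o, v) ∈ ω ∧ s(o, y) ∈ ω}) (forestEv V) = 0
  · rw [hzero]; exact Nat.zero_le _
  · -- a bad configuration exists; `u₀ ∪ {e}` is a good one
    obtain ⟨ω, hω, ⟨hF, he, hf⟩, -⟩ := exists_of_fibreCount_ne_zero _ _ _ _ hzero
    have hωeq := huniq ω hω he hf
    refine le_trans hle (one_le_fibreCount_of_mem M u₀ _ _ (insert s(o, v) u₀) ?_ ?_ ?_)
    · -- `(u₀ ∪ {e}) ∖ M = u₀`
      ext x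
      have h1 : x = s(o, v) → x ∉ u₀ := fun h => h ▸ heu
      have h2 : x = s(o, y) → x ∉ u₀ := fun h => h ▸ hfu
      simp only [mem_sdiff, mem_insert_iff, hM, mem_singleton_iff]
      tauto
    · -- `u₀ ∪ {e}` is a forest containing `e` (sub-configuration of `ω = u₀ ∪ {e,f}`)
      refine ⟨⟨fun p hp => hF.1 p ?_, hF.2.anti (openGraph_mono ?_)⟩, mem_insert _ _⟩
      · rw [hωeq]; exact mem_insert_of_mem _ hp
      · rw [hωeq]; exact subset_insert _ _
    · -- its partner `u₀ ∪ {f}` is a forest containing `f` (sub-configuration of `ω`)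
      have hpartner : insert s(o, v) u₀ ∆ M = insert s(o, y) u₀ := by
        ext x
        have h1 : x = s(o, v) → x ∉ u₀ := fun h => h ▸ heu
        have h2 : x = s(o, y) → x ∉ u₀ := fun h => h ▸ hfu
        have h3 : x = s(o, v) → ¬ x = s(o, y) := fun h h' => hef (h.symm.trans h')
        rw [Set.mem_symmDiff]
        simp only [mem_insert_iff, hM, mem_singleton_iff]
        tauto
      rw [hpartner]
      have hsub : insert s(o, y) u₀ ⊆ ω := by rw [hωeq]; exact insert_subset_insert (subset_insert _ _)
      exact ⟨⟨fun p hp => hF.1 p (hsub hp), hF.2.anti (openGraph_mono hsub)⟩, mem_insert _ _⟩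

end Base

/-! ### Contraction monotonicity ⇒ the node -/

/-- **CONTRACTION MONOTONICITY ⇒ THE SQUARE-FREE ADJACENT FOREST RAYLEIGH NODE.**  If pinning a free pair never increases the margin
(`AdjForestContractionMonoOn V`), then `bad ≤ good` on every fibre (`AdjForestRayleighNoSqOn V`): pin the free pairs other than `e, f` one at
a time and finish on the base fibre `{e, f}`. [cite: SempleWelsh2008, Conj. 1.1 (p. 2)] [cite: CibulkaHladkyLaCroixWagner2008, Thm. 1 (p. 2)]
[cite: Linusson2011, Prop. 2.6] -/
theorem adjForestRayleighNoSqOn_of_contractionMono (h : AdjForestContractionMonoOn V) : AdjForestRayleighNoSqOn V := by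
  -- strong induction on the number of free pairs
  suffices H : ∀ (k : ℕ) (M u₀ : BondConfig V), M.ncard = k → Disjoint u₀ M → ∀ (o v y : V), v ≠ y →
      fibreCount M u₀ (forestEv V ∩ {ω | s(o, v) ∈ ω ∧ s(o, y) ∈ ω}) (forestEv V) ≤
        fibreCount M u₀ (forestEv V ∩ {ω | s(o, v) ∈ ω}) (forestEv V ∩ {ω | s(o, y) ∈ ω}) from
    fun M u₀ hd o v y hvy => H _ M u₀ rfl hd o v y hvy
  intro k
  induction k using Nat.strong_induction_on with
  | _ k ih =>
    intro M u₀ hk hd o v y hvy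
    by_cases heM : s(o, v) ∈ M
    · by_cases hfM : s(o, y) ∈ M
      · by_cases hM : M = {s(o, v), s(o, y)}
        · exact adjForestNoSq_base hvy hM hd
        · -- a third free pair `g`: pin it
          have hss : ({s(o, v), s(o, y)} : BondConfig V) ⊂ M :=
            Set.ssubset_iff_subset_ne.2 ⟨insert_subset heM (singleton_subset_iff.2 hfM), Ne.symm hM⟩
          obtain ⟨g, hgM, hgnot⟩ := Set.exists_of_ssubset hss
          have hge : g ≠ s(o, v) := fun h' => hgnot (h' ▸ Or.inl rfl)
          have hgf : g ≠ s(o, y) := fun h' => hgnot (h' ▸ Or.inr rfl)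
          have hstep := h M u₀ hd o v y hvy g hgM hge hgf
          have hlt : (M \ {g}).ncard < k := by
            rw [← hk]; exact Set.ncard_sdiff_singleton_lt_of_mem hgM
          have hd' : Disjoint (insert g u₀) (M \ {g}) :=
            Set.disjoint_insert_left.2 ⟨fun h' => h'.2 rfl, hd.mono_right sdiff_subset⟩
          have hih := ih _ hlt (M \ {g}) (insert g u₀) rfl hd' o v y hvy
          omega
      · -- `f` not free
        by_cases hfu : s(o, y) ∈ u₀
        · exact (adjForestNoSq_bad_eq_good_of_pinned' hd hfu).le
        · rw [adjForestNoSq_bad_eq_zero_of_notMem' hfM hfu]; exact Nat.zero_le _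
    · -- `e` not free
      by_cases heu : s(o, v) ∈ u₀
      · exact (adjForestNoSq_bad_eq_good_of_pinned hd heu).le
      · rw [adjForestNoSq_bad_eq_zero_of_notMem heM heu]; exact Nat.zero_le _

/-- **`AdjForestContractionMonoPos → AdjForestRayleighNoSqPos`** (hence adjacent-edge negative correlation of the arboreal gas on every finite
graph, `ag_adjacent_negCorr_of_adjForestNoSq`). [cite: SempleWelsh2008, Conj. 1.1 (p. 2)] [cite: Grimmett2006, §1.5 (p. 13)] -/
theorem adjForestRayleighNoSqPos_of_contractionMonoPos (h : AdjForestContractionMonoPos) : AdjForestRayleighNoSqPos :=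
  fun n => adjForestRayleighNoSqOn_of_contractionMono (h n)

end FK
end Summit.CriticalPhenomena.PercolationContinuityZ3.Theorems

end
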